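import Literature.Topology.FourManifolds.ShapeRadialDiffeo
import Literature.Topology.FourManifolds.DiscTransport
import Literature.Topology.FourManifolds.OrientedConnectedSumUniqueness
import Literature.Topology.FourManifolds.OrientedConnectedSumTransportProofs
import HarnessLib

/-!
# The connected sum does not depend on the shape of the model disc

Topic `Literature/Topology/FourManifolds` (brick [B2] of the discharge of
`Literature.Topology.FourManifolds.nonempty_diffeomorph_of_isOrientedConnectedSum` at arbitrary
models, see `ConnectedSumUniquenessProofs.lean`).

Kervaire–Milnor (*Groups of homotopy spheres I* (1963), §2) glue `M ∖ i₁(0)` and `N ∖ i₂(0)`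
along `i₁ (t u) ∼ i₂ ((1 - t) u)`, `u` a unit vector of `ℝⁿ`; the independence of all choices
"up to orientation preserving diffeomorphism" (their Lemma 2.1) includes the independence of the
*orientation convention of the model disc*, which they absorb by a reflection — a linear isometry
of `ℝⁿ`. For the tree's relation `Literature.Topology.FourManifolds.connectedSumRel` over an
arbitrary finite-dimensional normed space `E`, whose unit sphere need not admit an
orientation-reversing linear isometry, one needs instead the following **shape lemma**: the
gluing along the unit disc of the norm and the gluing along the unit disc
`{‖T v‖ < 1}` of a linear automorphism `T` (same discs `k₁`, `k₂`) give diffeomorphic manifolds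
(`Literature.Topology.FourManifolds.nonempty_diffeomorph_of_isOpenGluing_shape`). This is the
folklore statement "the connected sum does not depend on the shape of the (star-shaped, smooth)
model disc" (cf. Kosinski, *Differential Manifolds* (1993), VI.1, where discs are arbitrary
embedded `Dᵐ`; Bröcker–Jänich (1982), §10).

## Proof

Both manifolds contain `A = M ∖ k₁(0)` and the exterior `W = N ∖ k₂(B̄(0, ρ₂))` of a small
ball as open pieces; for the norm-gluing `P` the pieces are embedded by `jA`, `jB|W`, for the
`T`-gluing `P'` by `jA'`, `jB' ∘ γ|W`, where `γ = k₂ ∘ β ∘ k₂⁻¹` (extended by the identity,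
`exists_diffeomorph_discTransport`) and `β` is the radial diffeomorphism of
`ShapeRadialDiffeo.lean`, which conjugates the inversion `σ v = (‖v‖⁻¹ - 1) v` of the unit
disc into the inversion `σ_T v = (‖T v‖⁻¹ - 1) v` of the `T`-disc on the relevant shell. The
identifications `jA a = jB w` and `jA' a = jB' (γ w)` then agree on `A × W`
(`Literature.Topology.FourManifolds.ShapeRadial.eq_kmInversion_of_beta_eq` is the converse
direction), both families of pieces cover, and the comparison map of open gluings
(`IsOpenGluing.exists_diffeomorph_comp_eq`, Kosinski VI.(1.1)) is a diffeomorphism `P ≅ P'`.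
The norm of `E` is assumed smooth away from `0` and `T` norm-non-decreasing (`‖v‖ ≤ ‖T v‖`),
which is what the application provides.

Everything is proved; no named facts.

## References

* M. Kervaire, J. Milnor, *Groups of homotopy spheres I*, Ann. of Math. 77 (1963), §2, Lemma 2.1.
  [KervaireMilnorAnnals1963]
* A. Kosinski, *Differential Manifolds* (1993), Ch. VI §1, Thm (1.1). [Kosinski1993]
-/

open scoped Manifold ContDiff Topology
open Set Function Filter Metric TopologicalSpace

noncomputable section

namespace Literature.Topology.FourManifolds

/-! ### The two disc inversions (model vector space) -/

namespace ShapeRadial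

variable {E : Type*} [NormedAddCommGroup E] [NormedSpace ℝ E]

/-- Kervaire–Milnor's **inversion of the punctured unit disc**, `σ v = (‖v‖⁻¹ - 1) v`: the
gluing map of the connected sum (`jA (k₁ v) = jB (k₂ (σ v))`). This is the same map as the
tree's `discInversionFun` (`ConnectedSumData.lean`, `((1 - ‖v‖) ‖v‖⁻¹) • v`), which however is
declared for *inner product* spaces only; here `E` is an arbitrary normed space, as the shape
lemma requires. [cite: KervaireMilnorAnnals1963, §2] -/
def kmInversion (v : E) : E := (‖v‖⁻¹ - 1) • v

/-- `‖σ v‖ = 1 - ‖v‖` on the punctured unit disc. [folklore] -/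
theorem norm_kmInversion {v : E} (h0 : 0 < ‖v‖) (h1 : ‖v‖ < 1) :
    ‖kmInversion v‖ = 1 - ‖v‖ := by
  have hf : 0 < ‖v‖⁻¹ - 1 := by rw [sub_pos, one_lt_inv₀ h0]; exact h1
  rw [kmInversion, norm_smul, Real.norm_of_nonneg hf.le]
  field_simp

/-- `σ v ≠ 0` on the punctured unit disc. [folklore] -/
theorem kmInversion_ne_zero {v : E} (h0 : 0 < ‖v‖) (h1 : ‖v‖ < 1) : kmInversion v ≠ 0 := by
  rw [← norm_pos_iff, norm_kmInversion h0 h1]; linarith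

/-- `σ` is an involution of the punctured unit disc. [folklore] -/
theorem kmInversion_kmInversion {v : E} (h0 : 0 < ‖v‖) (h1 : ‖v‖ < 1) :
    kmInversion (kmInversion v) = v := by
  rw [kmInversion, norm_kmInversion h0 h1, kmInversion, smul_smul]
  have h2 : (1 - ‖v‖) ≠ 0 := by linarith
  have h3 : ((1 - ‖v‖)⁻¹ - 1) * (‖v‖⁻¹ - 1) = 1 := by
    field_simp
    ring
  rw [h3, one_smul]

/-- The **inversion of the punctured `T`-unit disc**, `σ_T v = (‖T v‖⁻¹ - 1) v`. [folklore] -/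
def kmInversionT (T : E ≃L[ℝ] E) (v : E) : E := (‖T v‖⁻¹ - 1) • v

/-- `‖T (σ_T v)‖ = 1 - ‖T v‖` on the punctured `T`-unit disc. [folklore] -/
theorem norm_apply_kmInversionT (T : E ≃L[ℝ] E) {v : E} (h0 : 0 < ‖T v‖) (h1 : ‖T v‖ < 1) :
    ‖T (kmInversionT T v)‖ = 1 - ‖T v‖ := by
  have hf : 0 < ‖T v‖⁻¹ - 1 := by rw [sub_pos, one_lt_inv₀ h0]; exact h1
  rw [kmInversionT, map_smul, norm_smul, Real.norm_of_nonneg hf.le]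
  field_simp

/-- `σ_T v ≠ 0` on the punctured `T`-unit disc. [folklore] -/
theorem kmInversionT_ne_zero (T : E ≃L[ℝ] E) {v : E} (h0 : 0 < ‖T v‖) (h1 : ‖T v‖ < 1) :
    kmInversionT T v ≠ 0 := by
  intro h
  have h2 := norm_apply_kmInversionT T h0 h1
  rw [h, map_zero, norm_zero] at h2
  linarith

/-- `σ_T` is an involution of the punctured `T`-unit disc. [folklore] -/
theorem kmInversionT_kmInversionT (T : E ≃L[ℝ] E) {v : E} (h0 : 0 < ‖T v‖) (h1 : ‖T v‖ < 1) :
    kmInversionT T (kmInversionT T v) = v := by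
  rw [kmInversionT, norm_apply_kmInversionT T h0 h1, kmInversionT, smul_smul]
  have h2 : (1 - ‖T v‖) ≠ 0 := by linarith
  have h3 : ((1 - ‖T v‖)⁻¹ - 1) * (‖T v‖⁻¹ - 1) = 1 := by
    field_simp
    ring
  rw [h3, one_smul]

/-- `‖σ_T v‖ = (1 + c v) - ‖v‖` with `c` the radial shift (`1 + c v = ‖v‖ / ‖T v‖`).
[folklore] -/
theorem norm_kmInversionT (T : E ≃L[ℝ] E) {v : E} (h0 : 0 < ‖T v‖) (h1 : ‖T v‖ < 1) :
    ‖kmInversionT T v‖ = (1 + shift T v) - ‖v‖ := by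
  have hf : 0 < ‖T v‖⁻¹ - 1 := by rw [sub_pos, one_lt_inv₀ h0]; exact h1
  rw [kmInversionT, norm_smul, Real.norm_of_nonneg hf.le, one_add_shift]
  field_simp

/-- **Kervaire–Milnor's relation in terms of the inversion**: `connectedSumRel k₁ k₂ a b` iff
`a = k₁ v`, `b = k₂ (σ v)` for some `0 < ‖v‖ < 1`. [cite: KervaireMilnorAnnals1963, §2] -/
theorem connectedSumRel_iff_kmInversion {M N : Type*} (k₁ : E → M) (k₂ : E → N)
    (a : ↥({k₁ 0}ᶜ : Set M)) (b : ↥({k₂ 0}ᶜ : Set N)) :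
    connectedSumRel k₁ k₂ a b ↔
      ∃ v : E, 0 < ‖v‖ ∧ ‖v‖ < 1 ∧ (a : M) = k₁ v ∧ (b : N) = k₂ (kmInversion v) := by
  constructor
  · rintro ⟨u, t, hu, ht, ha, hb⟩
    have hn : ‖t • u‖ = t := by rw [norm_smul, Real.norm_of_nonneg ht.1.le, hu, mul_one]
    have ht0 : t ≠ 0 := ht.1.ne'
    refine ⟨t • u, by rw [hn]; exact ht.1, by rw [hn]; exact ht.2, ha, ?_⟩
    rw [hb, kmInversion, hn, smul_smul]
    congr 1
    field_simp
  · rintro ⟨v, h0, h1, ha, hb⟩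
    refine ⟨‖v‖⁻¹ • v, ‖v‖, ?_, ⟨h0, h1⟩, ?_, ?_⟩
    · rw [norm_smul, norm_inv, norm_norm, inv_mul_cancel₀ h0.ne']
    · rw [ha, smul_smul, mul_inv_cancel₀ h0.ne', one_smul]
    · rw [hb, kmInversion, smul_smul]
      congr 1
      field_simp

/-- **The `T`-disc relation in terms of the `T`-inversion**: the relation
`∃ u t, ‖u‖ = 1 ∧ t ∈ (0, 1) ∧ a = k₁ (T⁻¹ (t u)) ∧ b = k₂ (T⁻¹ ((1 - t) u))` holds iff
`a = k₁ v`, `b = k₂ (σ_T v)` for some `0 < ‖T v‖ < 1`. [folklore] -/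
theorem tRel_iff_kmInversionT {M N : Type*} (T : E ≃L[ℝ] E) (k₁ : E → M) (k₂ : E → N)
    (a : M) (b : N) :
    (∃ (u : E) (t : ℝ), ‖u‖ = 1 ∧ t ∈ Ioo (0 : ℝ) 1 ∧ a = k₁ (T.symm (t • u)) ∧
        b = k₂ (T.symm ((1 - t) • u))) ↔
      ∃ v : E, 0 < ‖T v‖ ∧ ‖T v‖ < 1 ∧ a = k₁ v ∧ b = k₂ (kmInversionT T v) := by
  constructor
  · rintro ⟨u, t, hu, ht, ha, hb⟩
    have hn : ‖t • u‖ = t := by rw [norm_smul, Real.norm_of_nonneg ht.1.le, hu, mul_one]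
    have ht0 : t ≠ 0 := ht.1.ne'
    refine ⟨T.symm (t • u), ?_, ?_, ha, ?_⟩
    · rw [T.apply_symm_apply, hn]; exact ht.1
    · rw [T.apply_symm_apply, hn]; exact ht.2
    · rw [hb, kmInversionT, T.apply_symm_apply, hn, ← map_smul, smul_smul]
      congr 2
      field_simp
  · rintro ⟨v, h0, h1, ha, hb⟩
    refine ⟨‖T v‖⁻¹ • T v, ‖T v‖, ?_, ⟨h0, h1⟩, ?_, ?_⟩
    · rw [norm_smul, norm_inv, norm_norm, inv_mul_cancel₀ h0.ne']
    · rw [ha, smul_smul, mul_inv_cancel₀ h0.ne', one_smul, T.symm_apply_apply]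
    · rw [hb, kmInversionT, smul_smul, ← map_smul, T.symm_apply_apply]
      congr 1
      field_simp

/-! ### The radial diffeomorphism conjugates `σ` into `σ_T` -/

/-- **Shell identity**: the radial shift by `c` applied to `σ v` is `σ_T v`, for
`0 < ‖v‖ < 1`: `((‖σ v‖ + c (σ v)) / ‖σ v‖) σ v = σ_T v`. [folklore] -/
theorem shell_smul_kmInversion (T : E ≃L[ℝ] E) {v : E} (h0 : 0 < ‖v‖) (h1 : ‖v‖ < 1) :
    ((‖kmInversion v‖ + shift T (kmInversion v)) / ‖kmInversion v‖) • kmInversion v =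
      kmInversionT T v := by
  have hf : 0 < ‖v‖⁻¹ - 1 := by rw [sub_pos, one_lt_inv₀ h0]; exact h1
  have hv : v ≠ 0 := norm_pos_iff.1 h0
  have hTv : 0 < ‖T v‖ := norm_pos_iff.2 (by simpa using hv)
  rw [norm_kmInversion h0 h1, kmInversion, shift_smul T hf.ne', smul_smul, kmInversionT]
  congr 1
  unfold shift
  have h2 : (1 - ‖v‖) ≠ 0 := by linarith
  field_simp
  ring

/-- On the open disc of radius `ρ₃`, `‖T v‖ < 1` (`Λ ρ₃ = 1/2`). [folklore] -/
theorem norm_apply_lt_one_of_lt_rho₃ (T : E ≃L[ℝ] E) {v : E} (h : ‖v‖ < rho₃ T) : ‖T v‖ < 1 := by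
  calc ‖T v‖ ≤ lam T * ‖v‖ := norm_apply_le_lam T v
    _ ≤ lam T * rho₃ T := by gcongr; exact (lam_pos T).le
    _ = 1 / 2 := lam_mul_rho₃ T
    _ < 1 := by norm_num

/-- **Converse of the shell identity.** Let `β : E → E` be radial with positive factor, equal
to the radial shift by `c` on the shell `ρ₂ < ‖v‖ ≤ 1`, and with `‖β v‖ > 1 + c v` for
`‖v‖ > 1` (the properties recorded by `exists_shapeDiffeo`). If `β v₀ = σ_T v` with `ρ₂ < ‖v₀‖`
and `0 < ‖T v‖ < 1`, then `0 < ‖v‖ < ρ₃` and `v₀ = σ v`. [folklore] -/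
theorem eq_kmInversion_of_beta_eq {T : E ≃L[ℝ] E} {β : E → E}
    (hshell : ∀ v, rho₂ T < ‖v‖ → ‖v‖ ≤ 1 → β v = ((‖v‖ + shift T v) / ‖v‖) • v)
    (hrad : ∀ v, ∃ μ : ℝ, 0 < μ ∧ β v = μ • v) (hout : ∀ v, 1 < ‖v‖ → 1 + shift T v < ‖β v‖)
    {v₀ v : E} (hv₀ : rho₂ T < ‖v₀‖) (ht0 : 0 < ‖T v‖) (ht1 : ‖T v‖ < 1)
    (heq : β v₀ = kmInversionT T v) : 0 < ‖v‖ ∧ ‖v‖ < rho₃ T ∧ v₀ = kmInversion v := by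
  have hv : v ≠ 0 := by rintro rfl; simp at ht0
  have hs : 0 < ‖v‖ := norm_pos_iff.2 hv
  have hv₀0 : v₀ ≠ 0 := by rintro rfl; have := rho₂_pos T; simp at hv₀; linarith
  have hs₀ : 0 < ‖v₀‖ := norm_pos_iff.2 hv₀0
  -- `v` is a positive multiple of `v₀`
  obtain ⟨μ, hμ, hβ⟩ := hrad v₀
  have hν : 0 < ‖T v‖⁻¹ - 1 := by rw [sub_pos, one_lt_inv₀ ht0]; exact ht1
  have hvv₀ : v = (μ / (‖T v‖⁻¹ - 1)) • v₀ := by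
    rw [hβ, kmInversionT] at heq
    rw [div_eq_mul_inv, mul_comm, ← smul_smul, heq, smul_smul, inv_mul_cancel₀ hν.ne', one_smul]
  set θ : ℝ := μ / (‖T v‖⁻¹ - 1) with hθ
  have hθpos : 0 < θ := div_pos hμ hν
  have hshift : shift T v = shift T v₀ := by rw [hvv₀, shift_smul T hθpos.ne']
  have hnv : ‖v‖ = θ * ‖v₀‖ := by rw [hvv₀, norm_smul, Real.norm_of_nonneg hθpos.le]
  -- norms: `‖β v₀‖ = (1 + c) - ‖v‖`
  have hnβ : ‖β v₀‖ = (1 + shift T v₀) - ‖v‖ := by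
    rw [heq, norm_kmInversionT T ht0 ht1, hshift]
  rcases le_or_gt ‖v₀‖ 1 with h₁ | h₁
  · -- shell case: `‖β v₀‖ = ‖v₀‖ + c`, so `‖v‖ = 1 - ‖v₀‖ < ρ₃`
    have h2 : ‖β v₀‖ = ‖v₀‖ + shift T v₀ := by
      rw [hshell v₀ hv₀ h₁, norm_smul, Real.norm_of_nonneg, div_mul_cancel₀ _ hs₀.ne']
      exact div_nonneg ((rho₃_pos T).le.trans (rho₃_le_rho₂_add_shift T hv₀0
        |>.trans (by linarith))) hs₀.le
    have h3 : ‖v‖ = 1 - ‖v₀‖ := by linarith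
    have h4 : ‖v‖ < rho₃ T := by
      have := rho₂_add_rho₃ T; linarith
    refine ⟨hs, h4, ?_⟩
    have hθ' : θ = ‖v‖ / ‖v₀‖ := by rw [hnv, mul_div_cancel_right₀ _ hs₀.ne']
    have h5 : (‖v‖⁻¹ - 1) * (‖v‖ / ‖v₀‖) = 1 := by
      rw [h3]
      have : (1 - ‖v₀‖) ≠ 0 := by linarith
      field_simp
      ring
    symm
    calc kmInversion v = (‖v‖⁻¹ - 1) • (θ • v₀) := by
          unfold kmInversion; exact congrArg ((‖v‖⁻¹ - 1) • ·) hvv₀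
      _ = ((‖v‖⁻¹ - 1) * (‖v‖ / ‖v₀‖)) • v₀ := by rw [smul_smul, hθ']
      _ = v₀ := by rw [h5, one_smul]
  · -- exterior case: contradiction with `‖β v₀‖ > 1 + c`
    have h2 := hout v₀ h₁
    rw [hnβ] at h2
    linarith

end ShapeRadial

/-! ### The shape lemma -/

section Shape

open ShapeRadial

variable {E : Type*} [NormedAddCommGroup E] [NormedSpace ℝ E] [FiniteDimensional ℝ E]
  {HM HN HP HP' : Type*} [TopologicalSpace HM] [TopologicalSpace HN] [TopologicalSpace HP]
  [TopologicalSpace HP']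
  {IM : ModelWithCorners ℝ E HM} {IN : ModelWithCorners ℝ E HN} {IP : ModelWithCorners ℝ E HP}
  {IP' : ModelWithCorners ℝ E HP'}
  {M N P P' : Type*} [TopologicalSpace M] [T2Space M] [ChartedSpace HM M]
  [TopologicalSpace N] [T2Space N] [ChartedSpace HN N] [IsManifold IN ∞ N]
  [TopologicalSpace P] [ChartedSpace HP P] [IsManifold IP ∞ P]
  [TopologicalSpace P'] [ChartedSpace HP' P'] [IsManifold IP' ∞ P']

/-- The **`T`-disc gluing relation**: `a = k₁ (T⁻¹ (t u))`, `b = k₂ (T⁻¹ ((1 - t) u))` for a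
unit vector `u` and `0 < t < 1`, i.e. Kervaire–Milnor's relation for the discs `k₁ ∘ T⁻¹`,
`k₂ ∘ T⁻¹`, read on the punctured pieces `M ∖ k₁(0)`, `N ∖ k₂(0)`. [folklore] -/
def tDiscRel (T : E ≃L[ℝ] E) (k₁ : E → M) (k₂ : E → N) (a : ↥({k₁ 0}ᶜ : Set M))
    (b : ↥({k₂ 0}ᶜ : Set N)) : Prop :=
  ∃ (u : E) (t : ℝ), ‖u‖ = 1 ∧ t ∈ Ioo (0 : ℝ) 1 ∧ (a : M) = k₁ (T.symm (t • u)) ∧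
    (b : N) = k₂ (T.symm ((1 - t) • u))

omit [FiniteDimensional ℝ E] [TopologicalSpace M] [T2Space M] [TopologicalSpace N] [T2Space N] in
/-- Unfolding of `tDiscRel` through the `T`-inversion (`tRel_iff_kmInversionT`). [folklore] -/
theorem tDiscRel_iff (T : E ≃L[ℝ] E) (k₁ : E → M) (k₂ : E → N) (a : ↥({k₁ 0}ᶜ : Set M))
    (b : ↥({k₂ 0}ᶜ : Set N)) :
    tDiscRel T k₁ k₂ a b ↔
      ∃ v : E, 0 < ‖T v‖ ∧ ‖T v‖ < 1 ∧ (a : M) = k₁ v ∧ (b : N) = k₂ (kmInversionT T v) :=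
  tRel_iff_kmInversionT T k₁ k₂ a b

/-- **Shape lemma: the connected sum does not depend on the shape of the model disc.** Let `E`
be a finite-dimensional normed space (of positive dimension) whose norm is smooth away from `0`,
`T` a linear automorphism of `E` with `‖v‖ ≤ ‖T v‖`, and `k₁ : E → M`, `k₂ : E → N` discs in
Hausdorff manifolds with arbitrary models with corners. If `P` is an open gluing of
`M ∖ k₁(0)` and `N ∖ k₂(0)` along Kervaire–Milnor's relation for the unit disc of the norm
(`connectedSumRel k₁ k₂`) and `P'` an open gluing of the same pieces along the relation for
the `T`-unit disc (`tDiscRel T k₁ k₂`), then `P` and `P'` are diffeomorphic. (Kervaire–Milnor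
(1963), Lemma 2.1, "well defined"; Kosinski (1993), VI.(1.1); proof in the module docstring.)
[cite: KervaireMilnorAnnals1963, §2, Lemma 2.1 (p. 505)] -/
theorem nonempty_diffeomorph_of_isOpenGluing_shape [Nontrivial E]
    (hN : ContDiffOn ℝ ∞ (fun v : E => ‖v‖) {0}ᶜ) (T : E ≃L[ℝ] E) (hT : ∀ v, ‖v‖ ≤ ‖T v‖)
    {k₁ : E → M} {k₂ : E → N} (hk₁ : Manifold.IsSmoothEmbedding 𝓘(ℝ, E) IM ∞ k₁)
    (hk₂ : Manifold.IsSmoothEmbedding 𝓘(ℝ, E) IN ∞ k₂)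
    (h : IsOpenGluing IM IN IP (A := puncture k₁) (B := puncture k₂) (P := P)
      (connectedSumRel k₁ k₂))
    (h' : IsOpenGluing IM IN IP' (A := puncture k₁) (B := puncture k₂) (P := P')
      (tDiscRel T k₁ k₂)) :
    Nonempty (P ≃ₘ⟮IP, IP'⟯ P') := by
  obtain ⟨jA, jB, hA, hAo, hB, hBo, hU, hR⟩ := h
  obtain ⟨jA', jB', hA', hAo', hB', hBo', hU', hR'⟩ := h'
  have hk₁i : Injective k₁ := hk₁.isEmbedding.injective
  have hk₂i : Injective k₂ := hk₂.isEmbedding.injective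
  -- the radial diffeomorphism and its transport `γ` to `N`
  obtain ⟨β, hβ0, hβ2, hβshell, hβrad, hβsmall, hβout⟩ := exists_shapeDiffeo hN T hT
  obtain ⟨γ, hγk, hγid⟩ := exists_diffeomorph_discTransport hk₂ β (R := 2) hβ2
  have hγfix : γ (k₂ 0) = k₂ 0 := by rw [hγk 0, hβ0]
  have hγ0 : ∀ x : N, γ x = k₂ 0 ↔ x = k₂ 0 := fun x => by
    constructor
    · intro hx
      exact γ.injective (hx.trans hγfix.symm)
    · rintro rfl
      exact hγfix
  obtain ⟨γB, hγB⟩ := exists_diffeomorph_opens γ (puncture k₂) (puncture k₂) fun x => by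
    rw [mem_puncture, mem_puncture]
    exact (hγ0 x).not
  -- the exterior piece `W = N ∖ k₂(B̄(0, ρ₂))`
  have hKc : IsClosed (k₂ '' closedBall (0 : E) (rho₂ T)) :=
    ((isCompact_closedBall (0 : E) _).image hk₂.contMDiff.continuous).isClosed
  set W : Opens N := ⟨(k₂ '' closedBall (0 : E) (rho₂ T))ᶜ, hKc.isOpen_compl⟩ with hW_def
  have hmemW : ∀ x : N, x ∈ W ↔ x ∉ k₂ '' closedBall (0 : E) (rho₂ T) := fun x => Iff.rfl
  have hWle : W ≤ puncture k₂ := by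
    intro x hx
    rw [mem_puncture]
    rintro rfl
    exact hx ⟨0, by simp [(rho₂_pos T).le], rfl⟩
  have hk₂W : ∀ v : E, k₂ v ∈ W ↔ rho₂ T < ‖v‖ := fun v => by
    rw [hmemW]
    constructor
    · intro hv
      by_contra hle
      exact hv ⟨v, by simpa using not_lt.1 hle, rfl⟩
    · rintro hv ⟨v', hv', he⟩
      rw [hk₂i he] at hv'
      simp at hv'
      linarith
  -- the four embeddings of the pieces `A = M ∖ k₁(0)` and `W`
  set kV : W → P := jB ∘ Opens.inclusion hWle with hkV
  set kV' : W → P' := (jB' ∘ γB) ∘ Opens.inclusion hWle with hkV'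
  have hkVa : ∀ w : W, kV w = jB ⟨w.1, hWle w.2⟩ := fun w => rfl
  have hkV'a : ∀ w : W, kV' w = jB' (γB ⟨w.1, hWle w.2⟩) := fun w => rfl
  have hKV : Manifold.IsSmoothEmbedding IN IP ∞ kV :=
    (isSmoothEmbedding_comp_opensInclusion hWle hB).1
  have hKV' : Manifold.IsSmoothEmbedding IN IP' ∞ kV' :=
    (isSmoothEmbedding_comp_opensInclusion hWle (hB'.comp_diffeomorph γB)).1
  have hjBo : IsOpenMap jB := (Topology.IsOpenEmbedding.mk hB.isEmbedding hBo).isOpenMap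
  have hjBo' : IsOpenMap jB' := (Topology.IsOpenEmbedding.mk hB'.isEmbedding hBo').isOpenMap
  have hKVo : IsOpen (range kV) := isOpen_range_comp_inclusion hWle hjBo
  have hKVo' : IsOpen (range kV') :=
    isOpen_range_comp_inclusion hWle (hjBo'.comp γB.toHomeomorph.isOpenMap)
  -- relation bookkeeping on the `P` side
  have hRσ : ∀ (a : puncture k₁) (b : puncture k₂), jA a = jB b ↔
      ∃ v : E, 0 < ‖v‖ ∧ ‖v‖ < 1 ∧ (a : M) = k₁ v ∧ (b : N) = k₂ (kmInversion v) :=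
    fun a b => (hR a b).trans (connectedSumRel_iff_kmInversion k₁ k₂ a b)
  have hRσ' : ∀ (a : puncture k₁) (b : puncture k₂), jA' a = jB' b ↔
      ∃ v : E, 0 < ‖T v‖ ∧ ‖T v‖ < 1 ∧ (a : M) = k₁ v ∧ (b : N) = k₂ (kmInversionT T v) :=
    fun a b => (hR' a b).trans (tDiscRel_iff T k₁ k₂ a b)
  -- **the identifications agree on `A × W`**
  have hagree : ∀ (a : puncture k₁) (w : W), kV' w = kV' w → (jA' a = kV' w ↔ jA a = kV w) := by
    intro a w _
    rw [hkVa, hkV'a]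
    constructor
    · -- from the `T`-relation to the norm relation
      intro h1
      obtain ⟨v, ht0, ht1, ha, hb⟩ := (hRσ' a _).1 h1
      rw [hγB] at hb
      -- `w = k₂ v₀` for some `v₀` with `ρ₂ < ‖v₀‖`
      have hwr : (w : N) ∈ range k₂ := by
        by_contra hwr
        have hw2 : (w : N) ∉ k₂ '' closedBall (0 : E) 2 := fun ⟨y, _, hy⟩ => hwr ⟨y, hy⟩
        have := hγid _ hw2
        rw [this] at hb
        exact hwr ⟨_, hb.symm⟩
      obtain ⟨v₀, hv₀⟩ := hwr
      have hv₀W : rho₂ T < ‖v₀‖ := (hk₂W v₀).1 (hv₀ ▸ w.2)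
      rw [← hv₀, hγk] at hb
      have hβv₀ : β v₀ = kmInversionT T v := hk₂i hb
      obtain ⟨hs0, hs1, hv₀σ⟩ :=
        eq_kmInversion_of_beta_eq hβshell hβrad hβout hv₀W ht0 ht1 hβv₀
      refine (hRσ a _).2 ⟨v, hs0, hs1.trans_le ((rho₃_le_half T).trans (by norm_num)), ha, ?_⟩
      show (w : N) = k₂ (kmInversion v)
      rw [← hv₀, hv₀σ]
    · -- from the norm relation to the `T`-relation
      intro h1
      obtain ⟨v, hs0, hs1, ha, hb⟩ := (hRσ a _).1 h1
      change (w : N) = k₂ (kmInversion v) at hb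
      have hσW : rho₂ T < ‖kmInversion v‖ := (hk₂W _).1 (hb ▸ w.2)
      have hvρ : ‖v‖ < rho₃ T := by
        rw [norm_kmInversion hs0 hs1] at hσW
        have := rho₂_add_rho₃ T; linarith
      have hTv0 : 0 < ‖T v‖ := norm_pos_iff.2 (by simpa using norm_pos_iff.1 hs0)
      have hTv1 : ‖T v‖ < 1 := norm_apply_lt_one_of_lt_rho₃ T hvρ
      refine (hRσ' a _).2 ⟨v, hTv0, hTv1, ha, ?_⟩
      rw [hγB]
      show γ (w : N) = k₂ (kmInversionT T v)
      rw [hb, hγk, hβshell _ hσW (by rw [norm_kmInversion hs0 hs1]; linarith),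
        shell_smul_kmInversion T hs0 hs1]
  -- **covers**
  have hcov : range jA ∪ range kV = univ := by
    refine eq_univ_of_forall fun p => ?_
    rcases eq_univ_iff_forall.1 hU p with ⟨a, rfl⟩ | ⟨b, rfl⟩
    · exact Or.inl ⟨a, rfl⟩
    · by_cases hbW : (b : N) ∈ W
      · exact Or.inr ⟨⟨b, hbW⟩, by rw [hkVa]⟩
      · -- `b = k₂ v₀` with `0 < ‖v₀‖ ≤ ρ₂`: glued to a point of `A`
        rw [hmemW, not_not] at hbW
        obtain ⟨v₀, hv₀, hbv₀⟩ := hbW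
        rw [mem_closedBall, dist_zero_right] at hv₀
        have hv₀0 : 0 < ‖v₀‖ := by
          rw [norm_pos_iff]; rintro rfl
          exact b.2 hbv₀.symm
        have hv₀1 : ‖v₀‖ < 1 := hv₀.trans_lt (rho₂_lt_one T)
        set v := kmInversion v₀ with hv
        have hvs0 : 0 < ‖v‖ := by rw [hv, norm_kmInversion hv₀0 hv₀1]; linarith
        have hvs1 : ‖v‖ < 1 := by rw [hv, norm_kmInversion hv₀0 hv₀1]; linarith
        have ha : k₁ v ∈ puncture k₁ := by
          rw [mem_puncture]; intro he
          exact (norm_pos_iff.1 hvs0) (hk₁i he)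
        left
        refine ⟨⟨k₁ v, ha⟩, (hRσ _ b).2 ⟨v, hvs0, hvs1, rfl, ?_⟩⟩
        rw [hv, kmInversion_kmInversion hv₀0 hv₀1, hbv₀]
  have hcov' : range jA' ∪ range kV' = univ := by
    refine eq_univ_of_forall fun p => ?_
    rcases eq_univ_iff_forall.1 hU' p with ⟨a, rfl⟩ | ⟨b, rfl⟩
    · exact Or.inl ⟨a, rfl⟩
    · set b' := γB.symm b with hb'
      have hbb' : γB b' = b := γB.apply_symm_apply b
      by_cases hbW : (b' : N) ∈ W
      · refine Or.inr ⟨⟨b', hbW⟩, ?_⟩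
        rw [hkV'a]
        exact (congrArg jB' hbb' : jB' (γB b') = jB' b)
      · -- `b' = k₂ v₀` with `0 < ‖v₀‖ ≤ ρ₂`; then `b = k₂ (β v₀)` is glued to a point of `A`
        rw [hmemW, not_not] at hbW
        obtain ⟨v₀, hv₀, hbv₀⟩ := hbW
        rw [mem_closedBall, dist_zero_right] at hv₀
        have hv₀0 : v₀ ≠ 0 := by
          rintro rfl
          exact b'.2 hbv₀.symm
        obtain ⟨hx0, hx1⟩ := hβsmall v₀ hv₀0 hv₀
        set x := β v₀ with hx
        have hbx : (b : N) = k₂ x := by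
          rw [← hbb', hγB, ← hbv₀, hγk]
        set w := kmInversionT T x with hw
        have hw0 : 0 < ‖T w‖ := by rw [hw, norm_apply_kmInversionT T hx0 hx1]; linarith
        have hw1 : ‖T w‖ < 1 := by rw [hw, norm_apply_kmInversionT T hx0 hx1]; linarith
        have hwne : w ≠ 0 := kmInversionT_ne_zero T hx0 hx1
        have ha : k₁ w ∈ puncture k₁ := by
          rw [mem_puncture]; intro he
          exact hwne (hk₁i he)
        left
        refine ⟨⟨k₁ w, ha⟩, (hRσ' _ b).2 ⟨w, hw0, hw1, rfl, ?_⟩⟩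
        rw [hw, kmInversionT_kmInversionT T hx0 hx1, hbx]
  -- **comparison of open gluings**
  obtain ⟨Ψ, -, -⟩ := IsOpenGluing.exists_diffeomorph_comp_eq (R := fun a w => jA a = kV w)
    hA hAo hKV hKVo hcov (fun a w => Iff.rfl) hA' hAo' hKV' hKVo' hcov'
    (fun a w => hagree a w rfl)
  exact ⟨Ψ⟩

end Shape

end Literature.Topology.FourManifolds
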